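import Mathlib
import Literature.Analysis.FluidPDE.GalerkinFlow
import HarnessLib

/-!
# Stub `stub_work_hasDerivAt` of line `Sketch` (crux `WazewskiBlock.UniformGalerkinTrap`)

The derivative of the WORK face `Wc(c) = ∑ₖ Re⟪ĝ k, c k⟫` of the three-face Ważewski block along
the Galerkin phase semiflow `galerkinPhaseFlow ν ĝ` on `X = ↥(galerkinSubspace S)`,
`S = freqBall N`, `ĝ = fourierRestrict S f`: for `ν ≥ 0`, `f ∈ L²` and `t > 0`,

  `d/dt Wc(Φ t x) = ∑ₖ Re⟪ĝ k, galerkinRHS S ν ĝ (Φ t x) k⟫`.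

Pure chain rule: `Wc` is a continuous `ℝ`-linear functional of the coefficient vector, and the
orbit `s ↦ ↑(Φ s x) = galerkinCoeffFlow ν ĝ s ↑x` solves the Galerkin ODE
(`isGalerkinODESolution_galerkinCoeffFlow`, two-sided derivative at `t > 0` by
`IsGalerkinODESolution.hasDerivAt`).
-/

noncomputable section
-- `Summit.<Summit>.<Problem>` is the tree's mandated summit-side namespace (CONVENTIONS §2); deliberate duplicate.
set_option linter.dupNamespace false
namespace Summit.AnomalousDissipation.AnomalousDissipation.Theorems.UniformGalerkinTrap.Sketch
open MeasureTheory Set Filter Topology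
open scoped ENNReal NNReal InnerProductSpace
open Literature.Analysis.FunctionSpaces Literature.Analysis.FunctionSpaces.Torus
open Literature.Analysis.FluidPDE

/-- Chain rule for the continuous `ℝ`-linear functional `c ↦ ∑ₖ Re⟪a k, c k⟫` of a coefficient
vector along a differentiable curve `β`: `d/dt ∑ₖ Re⟪a k, β t k⟫ = ∑ₖ Re⟪a k, β' t k⟫`. -/
theorem hasDerivAt_sum_re_inner_const_left {ι : Type*} [Fintype ι]
    {β : ℝ → ι → EuclideanSpace ℂ (Fin 3)} {v : ι → EuclideanSpace ℂ (Fin 3)}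
    (a : ι → EuclideanSpace ℂ (Fin 3)) {t : ℝ} (h : HasDerivAt β v t) :
    HasDerivAt (fun τ => ∑ k, (inner ℂ (a k) (β τ k)).re) (∑ k, (inner ℂ (a k) (v k)).re) t := by
  have hk : ∀ k : ι, HasDerivAt (fun τ => β τ k) (v k) t := fun k =>
    (ContinuousLinearMap.proj (R := ℝ) (φ := fun _ : ι => EuclideanSpace ℂ (Fin 3)) k).hasFDerivAt
      |>.comp_hasDerivAt t h
  have hk2 : ∀ k : ι,
      HasDerivAt (fun τ => (inner ℂ (a k) (β τ k)).re) ((inner ℂ (a k) (v k)).re) t := fun k => by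
    have h1 := ((innerSL ℂ (a k)).restrictScalars ℝ).hasFDerivAt.comp_hasDerivAt t (hk k)
    have h2 := Complex.reCLM.hasFDerivAt.comp_hasDerivAt t h1
    exact h2
  exact HasDerivAt.fun_sum (u := Finset.univ) fun k _ => hk2 k

/-- **The work face derivative along the Galerkin phase flow.** For `ν ≥ 0`, `f ∈ L²` and
`t > 0`, `d/dt ∑ₖ Re⟪ĝ k, (Φ t x) k⟫ = ∑ₖ Re⟪ĝ k, galerkinRHS S ν ĝ (Φ t x) k⟫`, where
`S = freqBall N`, `ĝ = fourierRestrict S f`, `Φ = galerkinPhaseFlow ν ĝ` (chain rule with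
`IsGalerkinODESolution.hasDerivAt` for the orbit `isGalerkinODESolution_galerkinCoeffFlow`). -/
theorem stub_work_hasDerivAt :
    ∀ (ν : ℝ) (N : ℕ) (f : UnitAddTorus (Fin 3) → EuclideanSpace ℝ (Fin 3))
      (x : ↥(galerkinSubspace (freqBall N : Finset (Fin 3 → ℤ)))) (t : ℝ),
      0 ≤ ν → MemLp f 2 volume → 0 < t →
      HasDerivAt
        (fun s => ∑ k, (inner ℂ (fourierRestrict (freqBall N : Finset (Fin 3 → ℤ)) f k)
            ((galerkinPhaseFlow ν (fourierRestrict (freqBall N : Finset (Fin 3 → ℤ)) f) s x :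
              ↥(freqBall N : Finset (Fin 3 → ℤ)) → EuclideanSpace ℂ (Fin 3)) k)).re)
        (∑ k, (inner ℂ (fourierRestrict (freqBall N : Finset (Fin 3 → ℤ)) f k)
            (galerkinRHS (freqBall N : Finset (Fin 3 → ℤ)) ν (fourierRestrict (freqBall N : Finset (Fin 3 → ℤ)) f)
              (galerkinPhaseFlow ν (fourierRestrict (freqBall N : Finset (Fin 3 → ℤ)) f) t x :
                ↥(freqBall N : Finset (Fin 3 → ℤ)) → EuclideanSpace ℂ (Fin 3)) k)).re) t := by
  intro ν N f x t hν hf ht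
  have hg : IsRealCoeff (fourierRestrict (freqBall N : Finset (Fin 3 → ℤ)) f) :=
    isRealCoeff_mFourierCoeff (hf.integrable one_le_two)
  have hα := (isGalerkinODESolution_galerkinCoeffFlow hν neg_mem_freqBall_of_mem hg x.2).hasDerivAt ht
  exact hasDerivAt_sum_re_inner_const_left _ hα

end Summit.AnomalousDissipation.AnomalousDissipation.Theorems.UniformGalerkinTrap.Sketch
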